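import Literature.AlgebraicGeometry.GroupSchemes.CartierDualCharacterYonedaHom
import Literature.AlgebraicGeometry.GroupSchemes.CartierDualLagrangian
import Literature.AlgebraicGeometry.GroupSchemes.GroupSchemeKernel
import HarnessLib

/-!
# A homomorphism `Y ⟶ G^D` with trivial kernel on finite points and `rk Y = rk G` is an isomorphism (Tate §(3.8) Yoneda form — part 4)

Layer `Literature/AlgebraicGeometry/GroupSchemes`, namespace `Literature.AlgebraicGeometry.GroupSchemes.AffineGroupScheme`; continues parts 1–3
★ `CartierDualCharacterPoints` ∕ `…Yoneda` ∕ `…YonedaHom` (the canonical pairing `⟪t, x⟫`, the homomorphism `w : Y ⟶ G^D` of a bimultiplicative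
character on points), ★ `GroupSchemeKernel` (`ker`, `kerι`, `kerLift`, closed for separated targets) and ★ `CartierDualLagrangian` §1
(`isIso_of_isClosedImmersion_of_finrank_alg_eq`).  THEOREMS ONLY (no definition, no instance, no notation, no named fact, no `sorry`, no
heartbeat budget).  Cell `hodgecm-mathlib` (D-0151), programme P6 «MOD» (crux item stmt-HodgeConjecture-24832, `--supports`), organ (σ1-a′)
«NON-DEGENERATE ⇒ ISOMORPHISM» = rows (a3) «mono iff trivial kernel on points» + «finite mono ⇒ closed immersion ⇒ ISO by ranks» of B-p08
(g32)'s σ1 road memo for the W-line `F0_P6b_WeilCartierDuality`, stub `stub_W1`.  Count-neutral: HC_CM is proved only modulo the printed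
citations until rung 0 closes; nothing here is about HC.

* §1 (any base, any homomorphism `w : Y ⟶ N` of group objects of `SchemeOver R`): `mono_of_forall_comp_eq_one` — trivial kernel on ALL
  `T`-points ⇒ `Mono w`; **`comp_eq_one_of_forall_finite`** — when `Y → Spec R` is finite and `N → Spec R` separated, a trivial kernel on points
  over FINITE `R`-algebras is a trivial kernel on all `T`-points (test the tautological point of the finite closed subgroup `Ker w ⊆ Y`).
* §2 (field `k`; `G` finite commutative, `Y` a finite affine group object): **`isIso_of_forall_comp_eq_one_of_finrank_alg_eq`** — a homomorphism
  `w : Y ⟶ G^D` with trivial kernel on finite points and `dim_k Γ(Y) = dim_k Γ(G)` is an ISOMORPHISM (Mathlib: a finite monomorphism is a closed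
  immersion, `IsClosedImmersion.iff_isFinite_and_mono`; ★ `isIso_of_isClosedImmersion_of_finrank_alg_eq`, ★ `finrank_alg_cartierDual`); the
  pairing form **`isIso_of_cartierPairing_nondegenerate`** — «`⟪Spec θ ≫ y ≫ w, x⟫ = 1` for all finite `θ, x` forces `y = 1`» + equal ranks ⇒ `IsIso w`
  (part 1 separation `eq_of_cartierPairing_tautPt_eq`).  With part 3 this closes the Cartier side of `Â[q] ≅ A[q]^D`: the W1 hand supplies the
  bimultiplicative Weil unit (part 3 ⇒ `w`), its non-degeneracy in `ŷ` (⇒ `hnd`) and `rk Â[q] = rk A[q]`.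

## References
* [Tate1997FiniteFlatGroupSchemes] J. Tate, *Finite flat group schemes*, in: Modular Forms and Fermat's Last Theorem (1997), §(3.7)–(3.8) pp. 144–146.
* [MumfordAV1970] D. Mumford, *Abelian Varieties* (1970), §15 Thm. 1 (p. 143), §20 pp. 183–185.
* [GortzWedhorn2020] U. Görtz, T. Wedhorn, *Algebraic Geometry I* (2nd ed. 2020), Definition 4.45 (2) (p. 117).
* [Waterhouse1979] W. C. Waterhouse, *Introduction to Affine Group Schemes* (1979), §14.1.
-/

set_option autoImplicit false

-- Mathlib's `Over`/`Scheme` APIs (and the tree's `DualAlg G := WithConv (Dual R (Alg G))`) are used across semireducible wrappers (as in the ★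
-- `GroupSchemes/*` files).
set_option backward.isDefEq.respectTransparency false

universe u

open CategoryTheory CategoryTheory.Limits AlgebraicGeometry MonoidalCategory CartesianMonoidalCategory TensorProduct WithConv

noncomputable section

namespace Literature.AlgebraicGeometry.GroupSchemes

namespace AffineGroupScheme

open scoped MonObj

open Literature.AlgebraicGeometry.Motives Literature.NumberTheory.DiophantineGeometry Literature.RingTheory.HopfAlgebra GroupSchemeKernel

variable {R : Type u} [CommRing R]

/-! ## §1 Trivial kernel on points: all points from finite points; monomorphism -/

section Kernel

variable {Y N : SchemeOver R} [GrpObj Y] [GrpObj N] (w : Y ⟶ N) [IsMonHom w]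

/-- **A homomorphism with trivial kernel on all `T`-points is a monomorphism** (`y₁ ≫ w = y₂ ≫ w ⇒ (y₁ y₂⁻¹) ≫ w = 1 ⇒ y₁ = y₂`).
[cite: GortzWedhorn2020, Definition 4.45 (2), p. 117] -/
theorem mono_of_forall_comp_eq_one (h : ∀ ⦃T : SchemeOver R⦄ (y : T ⟶ Y), y ≫ w = 1 → y = 1) : Mono w := by
  refine ⟨fun {T} y₁ y₂ hy => ?_⟩
  have hinj : Function.Injective (IsMonHom.monoidHom w T) :=
    (injective_iff_map_eq_one (IsMonHom.monoidHom w T)).mpr fun y hy => h y hy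
  exact hinj hy

omit [IsMonHom w] in
/-- **FINITE TEST RINGS SUFFICE for the trivial kernel** when `Y → Spec R` is finite and `N → Spec R` is separated: if `y ≫ w = 1 ⇒ y = 1` for
all points `y` of `Y` over FINITE `R`-algebras, then the same holds for all `T`-points.  The kernel `K = Ker w ⊆ Y` is a closed subgroup (★
`isClosedImmersion_kerι_left_of_isSeparated`), hence finite and affine; its tautological point `Spec Γ(K) ≅ K → Y` dies under `w`, so it is `1`,
so `K → Y` is the trivial morphism and every `T`-point in the kernel, factoring through `K` (★ `kerLift`), is `1`.
[cite: GortzWedhorn2020, Definition 4.45 (2), p. 117] -/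
theorem comp_eq_one_of_forall_finite [IsAffine Y.left] [IsFinite Y.hom] [IsSeparated N.hom]
    (h : ∀ ⦃T : Type u⦄ [CommRing T] [Algebra R T] [Module.Finite R T] (y : Motives.specOver R T ⟶ Y), y ≫ w = 1 → y = 1)
    ⦃T : SchemeOver R⦄ (y : T ⟶ Y) (hy : y ≫ w = 1) : y = 1 := by
  haveI : IsClosedImmersion (kerι w).left := isClosedImmersion_kerι_left_of_isSeparated w
  haveI : IsAffine (ker w).left := isAffine_of_isAffineHom (kerι w).left
  haveI : IsFinite (ker w).hom := by
    rw [← Over.w (kerι w)]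
    infer_instance
  haveI : Module.Finite R (Alg (ker w)) := Alg.moduleFinite (ker w)
  -- the tautological point of `K` dies under `w`, hence is `1`
  have hK : (isoSpecOver (ker w)).inv ≫ kerι w = 1 := h _ (by rw [Category.assoc, kerι_comp, MonObj.comp_one])
  have hι : kerι w = 1 := by
    rw [← cancel_epi (isoSpecOver (ker w)).inv, hK, MonObj.comp_one]
  rw [← kerLift_ι (f := w) y hy, hι, MonObj.comp_one]

end Kernel

/-! ## §2 Over a field: trivial kernel on finite points + equal ranks ⇒ isomorphism onto `G^D` -/

section Field

variable {k : Type u} [Field k] (G : SchemeOver k) [GrpObj G] [IsCommMonObj G] [IsAffine G.left] [Module.Free k (Alg G)]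
  [Module.Finite k (Alg G)] {Y : SchemeOver k} [GrpObj Y] [IsAffine Y.left] [IsFinite Y.hom] (w : Y ⟶ cartierDual G) [IsMonHom w]

/-- **A homomorphism `w : Y ⟶ G^D` with trivial kernel on FINITE points and `dim_k Γ(Y) = dim_k Γ(G)` is an ISOMORPHISM**: trivial kernel on all
points (§1) ⇒ `Mono w` ⇒ `w` is a finite monomorphism of schemes, i.e. a closed immersion (Mathlib `IsClosedImmersion.iff_isFinite_and_mono`) ⇒ an
isomorphism since `dim Γ(G^D) = dim Γ(G) = dim Γ(Y)` (★ `finrank_alg_cartierDual`, ★ `isIso_of_isClosedImmersion_of_finrank_alg_eq`).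
[cite: Tate1997FiniteFlatGroupSchemes, §(3.7)–(3.8) pp. 145–146] [cite: Waterhouse1979, §14.1 Theorem] -/
theorem isIso_of_forall_comp_eq_one_of_finrank_alg_eq
    (hker : ∀ ⦃T : Type u⦄ [CommRing T] [Algebra k T] [Module.Finite k T] (y : Motives.specOver k T ⟶ Y), y ≫ w = 1 → y = 1)
    (hrank : Module.finrank k (Alg Y) = Module.finrank k (Alg G)) : IsIso w := by
  haveI : Mono w := mono_of_forall_comp_eq_one w (comp_eq_one_of_forall_finite w hker)
  haveI : Mono w.left := inferInstance
  haveI : IsFinite w.left := by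
    haveI : IsFinite (w.left ≫ (cartierDual G).hom) := by
      rw [Over.w w]
      infer_instance
    exact IsFinite.of_comp w.left (cartierDual G).hom
  haveI : IsClosedImmersion w.left := (IsClosedImmersion.iff_isFinite_and_mono w.left).mpr ⟨inferInstance, inferInstance⟩
  haveI : Module.Finite k (Alg Y) := Alg.moduleFinite Y
  exact isIso_of_isClosedImmersion_of_finrank_alg_eq w (hrank.trans (finrank_alg_cartierDual G).symm)

/-- **NON-DEGENERATE ⇒ ISOMORPHISM (pairing form)**: a homomorphism `w : Y ⟶ G^D` such that «`⟪Spec θ ≫ y ≫ w, x⟫ = 1` for all finite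
`θ : T → T′`, `x ∈ G(T′)` forces `y = 1`» for points `y` over finite `k`-algebras, with `dim_k Γ(Y) = dim_k Γ(G)`, is an isomorphism — the
pairing values over the ONE finite test ring `T ⊗ Γ(G)` already pin `y ≫ w` down (part 1 `eq_of_cartierPairing_tautPt_eq`).  For the Weil
pairing: `hnd` is «`e_q(x, ŷ) = 1` for all `x` ⇒ `ŷ = 0`» and `hrank` is `rk Â[q] = q^{2g} = rk A[q]`.
[cite: Tate1997FiniteFlatGroupSchemes, §(3.8) p. 145] [cite: MumfordAV1970, §20 p. 184] -/
theorem isIso_of_cartierPairing_nondegenerate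
    (hnd : ∀ ⦃T : Type u⦄ [CommRing T] [Algebra k T] [Module.Finite k T] (y : Motives.specOver k T ⟶ Y),
      (∀ ⦃T' : Type u⦄ [CommRing T'] [Algebra k T'] [Module.Finite k T'] (θ : T →ₐ[k] T') (x : Motives.specOver k T' ⟶ G),
        cartierPairing G (AlgPoints.specOverMapOfAlgHom θ ≫ y ≫ w) x = 1) → y = 1)
    (hrank : Module.finrank k (Alg Y) = Module.finrank k (Alg G)) : IsIso w := by
  refine isIso_of_forall_comp_eq_one_of_finrank_alg_eq G w (fun T _ _ _ y hy => hnd y fun T' _ _ _ θ x => ?_) hrank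
  rw [hy, MonObj.comp_one, cartierPairing_one_left]

/-- **The converse reading: an isomorphism criterion from the one test ring `T ⊗ Γ(G)`** — it suffices that, for every finite `T` and
`y ∈ Y(T)`, `⟪Spec ι ≫ y ≫ w, x_univ⟫ = 1` over `T ⊗ Γ(G)` forces `y = 1`. [cite: Tate1997FiniteFlatGroupSchemes, §(3.8) p. 145] -/
theorem isIso_of_cartierPairing_tautPt_nondegenerate
    (hnd : ∀ ⦃T : Type u⦄ [CommRing T] [Algebra k T] [Module.Finite k T] (y : Motives.specOver k T ⟶ Y),
      cartierPairing G (AlgPoints.specOverMapOfAlgHom (Algebra.TensorProduct.includeLeft : T →ₐ[k] T ⊗[k] Alg G) ≫ y ≫ w) (tautPt G T) = 1 →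
        y = 1)
    (hrank : Module.finrank k (Alg Y) = Module.finrank k (Alg G)) : IsIso w := by
  refine isIso_of_forall_comp_eq_one_of_finrank_alg_eq G w (fun T _ _ _ y hy => hnd y ?_) hrank
  rw [hy, MonObj.comp_one, cartierPairing_one_left]

end Field

end AffineGroupScheme

end Literature.AlgebraicGeometry.GroupSchemes

end
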